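import Summits.Schanuel.Schanuel.Theorems.RootDecomp1KHyper61

/-!
# RootDecomp1KHyper — lens 6, generation 17 «BILOG STAIRCASE CELL» (BilogStair.lean edition 2 f0528a77…, 2567 l) — continuation (RootDecomp1KHyper62): §I `caseII_expFree` (the exp-free (II.y) half of `TransferII`, DECIDED, fact-free; `maxHeartbeats 1600000` as in the source) + §J member corollaries incl. `algebraicIndependent_pi_ell_or_pi_yB` (hypothesis-free)

(lens-6 g17 `BilogStair.lean` edition 2, sha256 f0528a77…5850, own farm rc 0 · 0 sorry · axioms std; critic ACK STATUS L1737 PORT GO LOW (registered, no credit);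
port by census-1 gen 15 in ten parts `RootDecomp1KHyper53`–`62` — see the PORT NOTE of part 53; `--supports stmt-Schanuel-33363`; rung 0.)
-/

open Complex Polynomial IntermediateField Filter
open scoped BigOperators

namespace Summit.Schanuel.Schanuel.Theorems.RootDecomp1KHyper

namespace HyperCell

namespace LatCell

namespace Bilog

variable {n : ℕ}
open Summit.Schanuel.Schanuel.Theorems.RootDecomp1KRelLiouvilleCell (mvPolyMeasure_one_of_polyMeasure)

/-- Norm of a product over a multiset with factors of norm `≤ b`. -/
private theorem norm_multiset_prod_map_le (s : Multiset ℂ) (g : ℂ → ℂ) {b : ℝ} (hb : 0 ≤ b)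
    (h : ∀ r ∈ s, ‖g r‖ ≤ b) : ‖(s.map g).prod‖ ≤ b ^ Multiset.card s := by
  induction s using Multiset.induction_on with
  | empty => simp
  | cons a s ih =>
    rw [Multiset.map_cons, Multiset.prod_cons, Multiset.card_cons, pow_succ, norm_mul, mul_comm]
    exact mul_le_mul (ih fun r hr => h r (Multiset.mem_cons_of_mem hr)) (h a (Multiset.mem_cons_self a s))
      (norm_nonneg _) (pow_nonneg hb _)

set_option maxHeartbeats 1600000 in
/-- **Case II, the exp-free rung (DECIDED).**  `Φ ≠ 0`, `Φ(π, ℓ) = 0`; `y` hyper-approximated along a flat,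
eventually positive staircase of the lattice `ℚπ + ℚℓ`.  Then no non-zero `G ∈ ℤ[x₁, x₂]` has `G(π, y) = 0`:
`π` and `y` are algebraically independent. -/
theorem caseII_expFree {ℓ y Y₁ Y₂ : ℝ} {a b : ℕ → ℚ} (hS : HyperStair ℓ y a b) (hflat : Flat a b Y₁ Y₂)
    (hb : ∀ᶠ k in atTop, 0 < b k) (Φ : MvPolynomial (Fin 2) ℤ) (hΦ : Φ ≠ 0)
    (hΦ0 : MvPolynomial.aeval ![(Real.pi : ℂ), (ℓ : ℂ)] Φ = 0)
    (G : MvPolynomial (Fin 2) ℤ) (hG : G ≠ 0) :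
    MvPolynomial.aeval ![(Real.pi : ℂ), (y : ℂ)] G ≠ 0 := by
  classical
  intro hGy
  set φ : MvPolynomial (Fin 1) ℤ →+* ℂ := (MvPolynomial.aeval ![(Real.pi : ℂ)]).toRingHom with hφ
  have hφa : ∀ Q, φ Q = MvPolynomial.aeval ![(Real.pi : ℂ)] Q := fun Q => rfl
  set EΦ := (toPoly Φ).natDegree with hEΦ
  set K := (toPoly G).natDegree with hK
  set gC : ℂ[X] := (toPoly G).map φ with hgC
  set pC : ℂ[X] := (toPoly Φ).map φ with hpC
  have hgC_eval : ∀ t, gC.eval t = MvPolynomial.aeval ![(Real.pi : ℂ), t] G := fun t => eval_map_toPoly G _ t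
  have hpC_eval : ∀ t, pC.eval t = MvPolynomial.aeval ![(Real.pi : ℂ), t] Φ := fun t => eval_map_toPoly Φ _ t
  have hgC0 : gC ≠ 0 := by
    intro h0
    have h1 : gC.coeff K = φ ((toPoly G).coeff K) := Polynomial.coeff_map _ _
    rw [h0, Polynomial.coeff_zero] at h1
    exact aeval_pi_ne_zero (Polynomial.leadingCoeff_ne_zero.mpr (toPoly_ne_zero hG)) h1.symm
  have hpC0 : pC ≠ 0 := by
    intro h0
    have h1 : pC.coeff EΦ = φ ((toPoly Φ).coeff EΦ) := Polynomial.coeff_map _ _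
    rw [h0, Polynomial.coeff_zero] at h1
    exact aeval_pi_ne_zero (Polynomial.leadingCoeff_ne_zero.mpr (toPoly_ne_zero hΦ)) h1.symm
  have hgCK : gC.natDegree ≤ K := Polynomial.natDegree_map_le
  -- `gC = (X - y)·qd`
  have hroot : gC.IsRoot (y : ℂ) := by rw [Polynomial.IsRoot.def, hgC_eval]; exact hGy
  set qd := gC /ₘ (Polynomial.X - Polynomial.C (y : ℂ)) with hqd
  have hfac : (Polynomial.X - Polynomial.C (y : ℂ)) * qd = gC := Polynomial.mul_divByMonic_eq_iff_isRoot.mpr hroot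
  have hqdK : qd.natDegree ≤ K := by
    rw [hqd, Polynomial.natDegree_divByMonic _ (Polynomial.monic_X_sub_C _)]
    exact (Nat.sub_le _ _).trans hgCK
  -- constants
  set Sg : ℝ := ∑ i ∈ Finset.range (gC.natDegree + 1), ‖gC.coeff i‖ with hSg
  set Sq : ℝ := ∑ i ∈ Finset.range (qd.natDegree + 1), ‖qd.coeff i‖ with hSq
  have hSg0 : 0 ≤ Sg := Finset.sum_nonneg fun _ _ => norm_nonneg _
  have hSq0 : 0 ≤ Sq := Finset.sum_nonneg fun _ _ => norm_nonneg _
  set RΦ : ℝ := 1 + (pC.roots.map fun r => ‖r‖).sum with hRΦ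
  have hRΦroot : ∀ ρ ∈ pC.roots, ‖ρ‖ ≤ RΦ := by
    intro ρ hρ
    have hnn : ∀ x ∈ pC.roots.map (fun r => ‖r‖), (0 : ℝ) ≤ x := by
      intro x hx
      obtain ⟨r, _, rfl⟩ := Multiset.mem_map.mp hx
      exact norm_nonneg _
    have h1 : ‖ρ‖ ≤ (pC.roots.map fun r => ‖r‖).sum :=
      Multiset.single_le_sum hnn _ (Multiset.mem_map_of_mem _ hρ)
    linarith
  have hRΦ0 : 0 ≤ RΦ := by
    have : 0 ≤ (pC.roots.map fun r => ‖r‖).sum :=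
      Multiset.sum_nonneg fun x hx => by
        obtain ⟨r, _, rfl⟩ := Multiset.mem_map.mp hx
        exact norm_nonneg _
    linarith
  set cE : ℂ := φ ((toPoly Φ).coeff EΦ) with hcE
  have hcE0 : cE ≠ 0 := aeval_lcoeff_ne_zero Φ hΦ
  set D₀ := max Φ.totalDegree G.totalDegree with hD₀
  obtain ⟨CM, τ, hCM, hmeas⟩ := mvPolyMeasure_pi₁ ((EΦ + K) * D₀)
  obtain ⟨c₂, hc₂⟩ : ∃ c₂ : ℝ, c₂ = (((((EΦ + 1 : ℕ) : ℤ) * mvlen Φ + mvlen G : ℤ)) : ℝ) := ⟨_, rfl⟩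
  have hc₂0 : 0 ≤ c₂ := by
    rw [hc₂]; exact_mod_cast add_nonneg (mul_nonneg (by positivity) (mvlen_nonneg _)) (mvlen_nonneg _)
  obtain ⟨cΛ, hcΛ⟩ : ∃ cΛ : ℝ, cΛ = Real.pi + RΦ + 1 := ⟨_, rfl⟩
  have hcΛ1 : 1 ≤ cΛ := by rw [hcΛ]; linarith [Real.pi_pos]
  have hcΛ0 : 0 ≤ cΛ := by linarith
  obtain ⟨C₁, hC₁⟩ : ∃ C₁ : ℝ, C₁ = ‖cE‖ ^ K * Sq * cΛ ^ K * ((1 + Sg) * cΛ ^ K) ^ EΦ := ⟨_, rfl⟩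
  obtain ⟨N₁, hN₁⟩ : ∃ N₁ : ℕ, N₁ = 2 * EΦ * K + K + K * EΦ := ⟨_, rfl⟩
  obtain ⟨C₃, hC₃⟩ : ∃ C₃ : ℝ, C₃ = (Nat.factorial (EΦ + K) : ℝ) * (c₂ * 3 ^ EΦ) ^ (EΦ + K) := ⟨_, rfl⟩
  obtain ⟨N₃, hN₃⟩ : ∃ N₃ : ℕ, N₃ = 2 * EΦ * (EΦ + K) := ⟨_, rfl⟩
  obtain ⟨C₀, hC₀⟩ : ∃ C₀ : ℝ, C₀ = CM * C₃ ^ τ * C₁ := ⟨_, rfl⟩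
  obtain ⟨N, hN⟩ : ∃ N : ℕ, N = N₃ * τ + N₁ := ⟨_, rfl⟩
  have hC₁0 : 0 ≤ C₁ := by rw [hC₁]; positivity
  have hC₃0 : 0 ≤ C₃ := by rw [hC₃]; positivity
  obtain ⟨m₀, hm₀⟩ := exists_exp_beats C₀ N
  -- the zero-branch polynomial `h(u, v) = ∏_{Φ(π,ρ)=0} G(π, πu + ρv)`
  obtain ⟨hρ, hhρ⟩ : ∃ hρ : ℂ → MvPolynomial (Fin 2) ℂ, hρ = fun ρ => MvPolynomial.aeval
    (![MvPolynomial.C (Real.pi : ℂ), MvPolynomial.C (Real.pi : ℂ) * MvPolynomial.X 0 +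
      MvPolynomial.C ρ * MvPolynomial.X 1] : Fin 2 → MvPolynomial (Fin 2) ℂ) G := ⟨_, rfl⟩
  have hρ_eval : ∀ ρ u v : ℂ, MvPolynomial.eval ![u, v] (hρ ρ) = gC.eval ((Real.pi : ℂ) * u + ρ * v) := by
    intro ρ u v
    rw [hhρ]
    dsimp only
    rw [eval_aeval_int, hgC_eval]
    have hfun : (fun i => MvPolynomial.eval ![u, v]
        ((![MvPolynomial.C (Real.pi : ℂ), MvPolynomial.C (Real.pi : ℂ) * MvPolynomial.X 0 +
          MvPolynomial.C ρ * MvPolynomial.X 1] : Fin 2 → MvPolynomial (Fin 2) ℂ) i)) =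
        ![(Real.pi : ℂ), (Real.pi : ℂ) * u + ρ * v] := by
      funext i
      match i with
      | 0 => simp
      | 1 => simp
    rw [hfun]
  have hρ_ne : ∀ ρ, hρ ρ ≠ 0 := by
    intro ρ h0
    apply hgC0
    refine Polynomial.funext fun t => ?_
    have h1 := hρ_eval ρ (t / Real.pi) 0
    rw [h0, map_zero, mul_zero, add_zero, mul_div_cancel₀ _ (by exact_mod_cast Real.pi_ne_zero)] at h1
    rw [← h1, Polynomial.eval_zero]
  obtain ⟨hP, hhP⟩ : ∃ hP : MvPolynomial (Fin 2) ℂ, hP = (pC.roots.map hρ).prod := ⟨_, rfl⟩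
  have hP0 : hP ≠ 0 := by
    rw [hhP]
    refine Multiset.prod_ne_zero fun hmem => ?_
    obtain ⟨ρ, _, hρ0⟩ := Multiset.mem_map.mp hmem
    exact hρ_ne ρ hρ0
  have hP_eval : ∀ u v : ℂ, MvPolynomial.eval ![u, v] hP =
      (pC.roots.map fun ρ => gC.eval ((Real.pi : ℂ) * u + ρ * v)).prod := by
    intro u v
    rw [hhP, map_multiset_prod, Multiset.map_map]
    exact congrArg _ (Multiset.map_congr rfl fun ρ _ => hρ_eval ρ u v)
  refine flat_contra_complex hflat hP hP0 ?_
  -- MAIN: for all large `k`, `h(a_k, b_k) = 0`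
  filter_upwards [hS m₀, hb] with k hk hbk
  -- the data of step `k`
  obtain ⟨H, hH⟩ : ∃ H : ℝ, H = hgt a b k := ⟨_, rfl⟩
  rw [← hH] at hk
  have hH3 : 3 ≤ H := hH ▸ three_le_hgt a b k
  have hH1 : 1 ≤ H := by linarith
  have hH0 : 0 < H := by linarith
  obtain ⟨A, hA⟩ : ∃ A : ℤ, A = (a k).num * (b k).den := ⟨_, rfl⟩
  obtain ⟨B, hB⟩ : ∃ B : ℤ, B = (b k).num * (a k).den := ⟨_, rfl⟩
  obtain ⟨E, hE⟩ : ∃ E : ℕ, E = (a k).den * (b k).den := ⟨_, rfl⟩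
  have hE0 : E ≠ 0 := by rw [hE]; exact Nat.mul_ne_zero (a k).den_nz (b k).den_nz
  have hEC : ((E : ℤ) : ℂ) ≠ 0 := by exact_mod_cast hE0
  have hEa : ((E : ℤ) : ℂ) * (a k : ℂ) = (A : ℂ) := by
    rw [hE, hA, Rat.cast_def]
    have : ((a k).den : ℂ) ≠ 0 := by exact_mod_cast (a k).den_nz
    field_simp
    push_cast
    ring
  have hEb : ((E : ℤ) : ℂ) * (b k : ℂ) = (B : ℂ) := by
    rw [hE, hB, Rat.cast_def]
    have : ((b k).den : ℂ) ≠ 0 := by exact_mod_cast (b k).den_nz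
    field_simp
    push_cast
    ring
  have hBC : (B : ℂ) ≠ 0 := by
    rw [hB]; push_cast
    exact mul_ne_zero (by exact_mod_cast (Rat.num_pos.mpr hbk).ne') (by exact_mod_cast (a k).den_nz)
  -- heights
  have hEH : ((E : ℤ) : ℝ) ≤ H ^ 2 := by
    have := den_mul_den_le_hgt_sq a b k
    rw [hE, hH]; push_cast at this ⊢; exact this
  have hAH : |(A : ℝ)| ≤ H ^ 2 := by rw [hA, hH]; exact (num_mul_den_le_hgt_sq a b k).1
  have hBH : |(B : ℝ)| ≤ H ^ 2 := by rw [hB, hH]; exact (num_mul_den_le_hgt_sq a b k).2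
  have haH : |(a k : ℝ)| ≤ H := by rw [hH]; exact (abs_cast_le_hgt a b k).1
  have hbH : |(b k : ℝ)| ≤ H := by rw [hH]; exact (abs_cast_le_hgt a b k).2
  -- the approximant `r = a_k π + b_k ℓ`
  set r : ℂ := (a k : ℂ) * (Real.pi : ℂ) + (b k : ℂ) * (ℓ : ℂ) with hr
  set ε : ℝ := |y - ((a k : ℝ) * Real.pi + (b k : ℝ) * ℓ)| with hε
  have hε0 : 0 ≤ ε := abs_nonneg _
  have hry : ‖r - (y : ℂ)‖ = ε := by
    rw [hr, hε, show (a k : ℂ) * (Real.pi : ℂ) + (b k : ℂ) * (ℓ : ℂ) - (y : ℂ) =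
      ((((a k : ℝ) * Real.pi + (b k : ℝ) * ℓ - y : ℝ)) : ℂ) by push_cast; ring, Complex.norm_real,
      Real.norm_eq_abs, abs_sub_comm]
  -- `f = Φ̃(π, ·)`
  set f : ℂ[X] := (toPoly (twist Φ A B E)).map φ with hf
  have hf_eval : ∀ t, f.eval t = MvPolynomial.aeval ![(Real.pi : ℂ), t] (twist Φ A B E) :=
    fun t => eval_map_toPoly _ _ t
  obtain ⟨hfdeg, hflc⟩ := natDegree_leadingCoeff_ftwist Φ hΦ A B E hE0
  rw [← hf] at hfdeg hflc
  have hf0 : f ≠ 0 := by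
    intro h0
    rw [h0, Polynomial.leadingCoeff_zero] at hflc
    exact mul_ne_zero hcE0 (pow_ne_zero _ hEC) (by rw [hcE, hφa]; exact hflc.symm)
  have hfr : f.eval r = 0 := by
    rw [hf_eval, aeval_twist_of_eq Φ A B E (ρ := (ℓ : ℂ)) (by rw [hr, mul_add, ← mul_assoc, ← mul_assoc, hEa, hEb]; ring),
      hΦ0, mul_zero]
  have hr_mem : r ∈ f.roots := (Polynomial.mem_roots hf0).mpr hfr
  -- every root `r'` of `f` is `a_k π + b_k ρ'` with `Φ(π, ρ') = 0`
  have hroots : ∀ r' ∈ f.roots, ∃ ρ' ∈ pC.roots, r' = (a k : ℂ) * Real.pi + (b k : ℂ) * ρ' := by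
    intro r' hr'
    have h0 : f.eval r' = 0 := (Polynomial.mem_roots hf0).mp hr'
    set ρ' : ℂ := (((E : ℤ) : ℂ) * r' - (A : ℂ) * Real.pi) / (B : ℂ) with hρ'
    have hrel : ((E : ℤ) : ℂ) * r' - (A : ℂ) * Real.pi = (B : ℂ) * ρ' := by
      rw [hρ', mul_div_cancel₀ _ hBC]
    rw [hf_eval, aeval_twist_of_eq Φ A B E hrel] at h0
    have hΦρ : MvPolynomial.aeval ![(Real.pi : ℂ), ρ'] Φ = 0 :=
      (mul_eq_zero.mp h0).resolve_left (pow_ne_zero _ hBC)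
    refine ⟨ρ', (Polynomial.mem_roots hpC0).mpr (by rw [Polynomial.IsRoot.def, hpC_eval]; exact hΦρ), ?_⟩
    have ha' : (a k : ℂ) = (A : ℂ) / ((E : ℤ) : ℂ) := by rw [← hEa, mul_div_cancel_left₀ _ hEC]
    have hb' : (b k : ℂ) = (B : ℂ) / ((E : ℤ) : ℂ) := by rw [← hEb, mul_div_cancel_left₀ _ hEC]
    rw [ha', hb']
    field_simp
    linear_combination hrel
  -- norms of roots and of the values of `gC`
  have hroot_norm : ∀ r' ∈ f.roots, max 1 ‖r'‖ ≤ H * cΛ := by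
    intro r' hr'
    obtain ⟨ρ', hρ', rfl⟩ := hroots r' hr'
    refine max_le ?_ ?_
    · nlinarith
    · calc ‖(a k : ℂ) * Real.pi + (b k : ℂ) * ρ'‖ ≤ ‖(a k : ℂ) * Real.pi‖ + ‖(b k : ℂ) * ρ'‖ := norm_add_le _ _
        _ = |(a k : ℝ)| * Real.pi + |(b k : ℝ)| * ‖ρ'‖ := by
            rw [norm_mul, norm_mul, show ((a k : ℚ) : ℂ) = ((a k : ℝ) : ℂ) by push_cast; rfl,
              show ((b k : ℚ) : ℂ) = ((b k : ℝ) : ℂ) by push_cast; rfl, Complex.norm_real, Complex.norm_real,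
              Complex.norm_real, Real.norm_eq_abs, Real.norm_eq_abs, Real.norm_eq_abs, abs_of_pos Real.pi_pos]
        _ ≤ H * Real.pi + H * RΦ := add_le_add (mul_le_mul_of_nonneg_right haH Real.pi_pos.le)
            (mul_le_mul hbH (hRΦroot ρ' hρ') (norm_nonneg _) (by linarith))
        _ ≤ H * cΛ := by rw [hcΛ]; nlinarith
  have hHc1 : 1 ≤ H * cΛ := by nlinarith
  have hg_val : ∀ r' ∈ f.roots, ‖gC.eval r'‖ ≤ (1 + Sg) * (H * cΛ) ^ K := by
    intro r' hr'
    calc ‖gC.eval r'‖ ≤ Sg * max 1 ‖r'‖ ^ gC.natDegree := norm_eval_le gC r'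
      _ ≤ (1 + Sg) * (H * cΛ) ^ K := by
          refine mul_le_mul (by linarith) ?_ (by positivity) (by linarith)
          exact (pow_le_pow_left₀ (by positivity) (hroot_norm r' hr') _).trans
            (pow_le_pow_right₀ hHc1 hgCK)
  have hg_r : ‖gC.eval r‖ ≤ ε * (Sq * (H * cΛ) ^ K) := by
    rw [← hfac, Polynomial.eval_mul, norm_mul, Polynomial.eval_sub, Polynomial.eval_X, Polynomial.eval_C, hry]
    refine mul_le_mul_of_nonneg_left ?_ hε0
    calc ‖qd.eval r‖ ≤ Sq * max 1 ‖r‖ ^ qd.natDegree := norm_eval_le qd r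
      _ ≤ Sq * (H * cΛ) ^ K := by
          refine mul_le_mul_of_nonneg_left ?_ hSq0
          exact (pow_le_pow_left₀ (by positivity) (hroot_norm r hr_mem) _).trans (pow_le_pow_right₀ hHc1 hqdK)
  -- UPPER BOUND for `|R(π)|`
  have hres_eval := aeval_resII Φ hΦ G A B E hE0 f hf
  have hub : ‖MvPolynomial.aeval ![(Real.pi : ℂ)] (resII Φ G A B E)‖ ≤ C₁ * H ^ N₁ * ε := by
    rw [hres_eval, norm_mul, norm_pow, ← Multiset.cons_erase hr_mem, Multiset.map_cons, Multiset.prod_cons,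
      norm_mul]
    have h1 : ‖f.leadingCoeff‖ ≤ ‖cE‖ * (H ^ 2) ^ EΦ := by
      rw [hflc, norm_mul, norm_pow, hcE, hφa]
      refine mul_le_mul_of_nonneg_left (pow_le_pow_left₀ (norm_nonneg _) ?_ _) (norm_nonneg _)
      rw [show ((E : ℤ) : ℂ) = (((E : ℤ) : ℝ) : ℂ) by push_cast; rfl, Complex.norm_real, Real.norm_eq_abs,
        abs_of_nonneg (by positivity)]
      exact hEH
    have h2 : ‖((f.roots.erase r).map fun r => gC.eval r).prod‖ ≤ ((1 + Sg) * (H * cΛ) ^ K) ^ EΦ := by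
      refine (norm_multiset_prod_map_le _ _ (by positivity) fun r' hr' =>
        hg_val r' (Multiset.mem_of_mem_erase hr')).trans ?_
      refine pow_le_pow_right₀ ?_ ?_
      · have : 1 ≤ (H * cΛ) ^ K := one_le_pow₀ hHc1
        nlinarith
      · calc Multiset.card (f.roots.erase r) ≤ Multiset.card f.roots := Multiset.card_erase_le
          _ ≤ f.natDegree := Polynomial.card_roots' f
          _ = EΦ := hfdeg
    calc ‖f.leadingCoeff‖ ^ K * (‖gC.eval r‖ * ‖((f.roots.erase r).map fun r => gC.eval r).prod‖)
        ≤ (‖cE‖ * (H ^ 2) ^ EΦ) ^ K * ((ε * (Sq * (H * cΛ) ^ K)) * ((1 + Sg) * (H * cΛ) ^ K) ^ EΦ) := by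
          refine mul_le_mul (pow_le_pow_left₀ (norm_nonneg _) h1 K)
            (mul_le_mul hg_r h2 (norm_nonneg _) (by positivity)) (by positivity) (by positivity)
      _ = C₁ * H ^ N₁ * ε := by rw [hC₁, hN₁]; simp only [mul_pow]; ring
  -- LOWER BOUND: `R ≠ 0` is impossible
  have hres0 : resII Φ G A B E = 0 := by
    by_contra hne
    obtain ⟨hlen, hdegR⟩ := resII_bounds Φ G A B E
    have hm := hmeas _ hne (by rw [hD₀]; exact hdegR)
    -- length in terms of `H`
    have hX0 : (((E : ℤ) + |A| + |B| : ℤ) : ℝ) ≤ 3 * H ^ 2 := by push_cast at hEH ⊢; linarith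
    have hlenR : ((mvlen (resII Φ G A B E) : ℤ) : ℝ) ≤ C₃ * H ^ N₃ := by
      have h1 : ((mvlen (resII Φ G A B E) : ℤ) : ℝ) ≤ (Nat.factorial (EΦ + K) : ℝ) *
          ((((EΦ + 1 : ℕ) : ℤ) : ℝ) * (mvlen Φ : ℝ) * (((E : ℤ) + |A| + |B| : ℤ) : ℝ) ^ EΦ + (mvlen G : ℝ)) ^
            (EΦ + K) := by exact_mod_cast hlen
      refine h1.trans ?_
      have hX00 : (0 : ℝ) ≤ (((E : ℤ) + |A| + |B| : ℤ) : ℝ) := by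
        exact_mod_cast (by positivity : (0:ℤ) ≤ (E : ℤ) + |A| + |B|)
      have hΦl : (0 : ℝ) ≤ (mvlen Φ : ℝ) := by exact_mod_cast mvlen_nonneg Φ
      have hGl : (0 : ℝ) ≤ (mvlen G : ℝ) := by exact_mod_cast mvlen_nonneg G
      have h31 : (1 : ℝ) ≤ (3 * H ^ 2) ^ EΦ := one_le_pow₀ (by nlinarith)
      have hinner : (((EΦ + 1 : ℕ) : ℤ) : ℝ) * (mvlen Φ : ℝ) * (((E : ℤ) + |A| + |B| : ℤ) : ℝ) ^ EΦ +
          (mvlen G : ℝ) ≤ c₂ * (3 * H ^ 2) ^ EΦ := by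
        have t1 : (((EΦ + 1 : ℕ) : ℤ) : ℝ) * (mvlen Φ : ℝ) * (((E : ℤ) + |A| + |B| : ℤ) : ℝ) ^ EΦ ≤
            (((EΦ + 1 : ℕ) : ℤ) : ℝ) * (mvlen Φ : ℝ) * (3 * H ^ 2) ^ EΦ :=
          mul_le_mul_of_nonneg_left (pow_le_pow_left₀ hX00 hX0 _) (by positivity)
        have t2 : (mvlen G : ℝ) ≤ (mvlen G : ℝ) * (3 * H ^ 2) ^ EΦ := le_mul_of_one_le_right hGl h31
        have t3 : c₂ * (3 * H ^ 2) ^ EΦ = (((EΦ + 1 : ℕ) : ℤ) : ℝ) * (mvlen Φ : ℝ) * (3 * H ^ 2) ^ EΦ +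
            (mvlen G : ℝ) * (3 * H ^ 2) ^ EΦ := by rw [hc₂]; push_cast; ring
        linarith
      have hin0 : (0 : ℝ) ≤ (((EΦ + 1 : ℕ) : ℤ) : ℝ) * (mvlen Φ : ℝ) * (((E : ℤ) + |A| + |B| : ℤ) : ℝ) ^ EΦ +
          (mvlen G : ℝ) := by positivity
      calc (Nat.factorial (EΦ + K) : ℝ) *
            ((((EΦ + 1 : ℕ) : ℤ) : ℝ) * (mvlen Φ : ℝ) * (((E : ℤ) + |A| + |B| : ℤ) : ℝ) ^ EΦ + (mvlen G : ℝ)) ^ (EΦ + K)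
          ≤ (Nat.factorial (EΦ + K) : ℝ) * (c₂ * (3 * H ^ 2) ^ EΦ) ^ (EΦ + K) :=
            mul_le_mul_of_nonneg_left (pow_le_pow_left₀ hin0 hinner _) (by positivity)
        _ = C₃ * H ^ N₃ := by rw [hC₃, hN₃]; simp only [mul_pow]; ring
    have hfin : (1 : ℝ) ≤ C₀ * H ^ N * ε := by
      calc (1 : ℝ) ≤ CM * ((mvlen (resII Φ G A B E) : ℤ) : ℝ) ^ τ *
            ‖MvPolynomial.aeval ![(Real.pi : ℂ)] (resII Φ G A B E)‖ := hm
        _ ≤ CM * (C₃ * H ^ N₃) ^ τ * (C₁ * H ^ N₁ * ε) := by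
            refine mul_le_mul (mul_le_mul_of_nonneg_left (pow_le_pow_left₀ (by exact_mod_cast mvlen_nonneg _)
              hlenR τ) hCM.le) hub (norm_nonneg _) (by positivity)
        _ = C₀ * H ^ N * ε := by rw [hC₀, hN]; ring
    have := hm₀ H ε hH3 hε0 hk
    linarith
  -- ZERO BRANCH: some root `r'` of `f` has `G(π, r') = 0`
  have hprod0 : (f.roots.map fun r => gC.eval r).prod = 0 := by
    have h1 := hres_eval
    rw [hres0, map_zero] at h1
    exact (mul_eq_zero.mp h1.symm).resolve_left (pow_ne_zero _ (by
      rw [hflc]; exact mul_ne_zero hcE0 (pow_ne_zero _ hEC)))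
  obtain ⟨r', hr', hgr'⟩ : ∃ r' ∈ f.roots, gC.eval r' = 0 := by
    have h0 : (0 : ℂ) ∈ f.roots.map (fun r => gC.eval r) := Multiset.prod_eq_zero_iff.mp hprod0
    obtain ⟨r', hr', h⟩ := Multiset.mem_map.mp h0
    exact ⟨r', hr', h⟩
  obtain ⟨ρ', hρ', hr'eq⟩ := hroots r' hr'
  rw [hP_eval]
  refine Multiset.prod_eq_zero ?_
  refine Multiset.mem_map.mpr ⟨ρ', hρ', ?_⟩
  rw [← hgr', hr'eq]
  ring_nf

/-! ## §J  Member corollaries (HYPOTHESIS-FREE): in Case II `π` and `y_B` are algebraically independent;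
unconditionally one of the pairs `(π, ℓ₀)`, `(π, y_B)` is algebraically independent. -/

/-- Case II for the member: if `π` and `ℓ₀ = arctan (4/3)` are algebraically dependent, then `π` and `y_B` are
algebraically independent over `ℚ`. -/
theorem algebraicIndependent_pi_yB_of_dep
    (hdep : ¬ AlgebraicIndependent ℚ ![(Real.pi : ℂ), (ell : ℂ)]) :
    AlgebraicIndependent ℚ ![(Real.pi : ℂ), (yB : ℂ)] := by
  obtain ⟨Φ, hΦ, hΦ0⟩ := exists_int_relation hdep
  by_contra hG
  obtain ⟨G, hG, hG0⟩ := exists_int_relation hG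
  exact caseII_expFree hyperStair_B flat_B bB_pos Φ hΦ hΦ0 G hG hG0

/-- Unconditionally: `(π, ℓ₀)` or `(π, y_B)` is an algebraically independent pair. -/
theorem algebraicIndependent_pi_ell_or_pi_yB :
    AlgebraicIndependent ℚ ![(Real.pi : ℂ), (ell : ℂ)] ∨ AlgebraicIndependent ℚ ![(Real.pi : ℂ), (yB : ℂ)] :=
  or_iff_not_imp_left.mpr algebraicIndependent_pi_yB_of_dep

end Bilog
end LatCell
end HyperCell
end Summit.Schanuel.Schanuel.Theorems.RootDecomp1KHyper
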